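import Mathlib
import Summits.ValiantsHypothesis.ValiantsHypothesis.Theses.RigidityForcesSymmetry
import Summits.ValiantsHypothesis.ValiantsHypothesis.Theses.RigidMinimalReps
import Literature.Computability.AlgebraicComplexity.LandsbergRessayreProofs

/-!
# `TorusBound` — SHARED birth skeleton (BC3) for the two crux items with this decl name:
# `RigidityForcesSymmetry.TorusBound` (stmt-ValiantsHypothesis-4164) and
# `RigidMinimalReps.TorusBound` (stmt-ValiantsHypothesis-5114)

The crux workfile directory `Cruxes/TorusBound/` is keyed by the decl's SHORT name, so the two sibling
cruxes share it and share this `Lines/birth.lean` (first registered for stmt-4164, 2026-08-17T02:37Z; §4 and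
the stmt-5114 conclusion added by the stmt-5114 registrar the same hour — §1–§3 are kept VERBATIM, so the
stubs registered on stmt-4164 are unchanged in name and signature).  The two statements differ only in the
generator set of the two-sided torus: stmt-5114 additionally records `∀ i, d i ≠ 0` and `∀ j, e j ≠ 0`, which
is automatic for an INVERTIBLE diagonal `diag(d_k e_j)` (`§4`, `twoSidedGens_subset`), so the two subgroup
closures coincide and the SAME two stubs conclude BOTH cruxes by name:
`TorusBound_of` / `TorusBound_proof` (→ `RigidityForcesSymmetry.TorusBound`, §3) and
`RigidMinimalReps.TorusBound_of` / `RigidMinimalReps.TorusBound_proof` (→ `RigidMinimalReps.TorusBound`, §4).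

Crux (rank 3 of route-ValiantsHypothesis-RigidityForcesSymmetry; verbatim-equivalent rank 3 crux of
route-ValiantsHypothesis-RigidMinimalReps), BY NAME:
`Summit.ValiantsHypothesis.ValiantsHypothesis.Theses.RigidityForcesSymmetry.TorusBound` —
for `n ≥ 3`, every affine determinantal representation `Ã = Λ + Σ_{kj} x_{kj} A_{kj}` of `per_n` over `ℂ`
(size `m`) that is equivariant with exact lifts (`IsEquivariantDetRepr`) for the TWO-SIDED torus
`x_{kj} ↦ d_k e_j x_{kj}` has `2^n - 1 ≤ m` ("LR17 Thm 2.8 minus the Weyl group, plus the right torus";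
tight by Grenet's representation).

## The line (= the route's own TWO-LAYER PLAN for this crux, typed): ONE generic two-sided torus element

Convention as in the crux: `n` = size of the permanent, `m` = size of the matrix (the tree's LR17 files
use the opposite letters).  Let `p_1,…,p_n, q_1,…,q_n` be `2n` DISTINCT primes and let `(g, h) ∈ GL_m × GL_m`
be an exact lift of the single torus element `t : x_{kj} ↦ p_k q_j x_{kj}`, i.e. (on constant and linear
parts, `LRPencil.coeffMat`, `constPart`)  `g Λ = Λ h` and `g A_{kj} = p_k q_j · A_{kj} h`.
By von zur Gathen regularity (`n ≥ 3`; PROVED in the tree, `vonzurGathen1987_perm_detRepr_rank_holds`)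
`rank Λ = m - 1`, so `ker Λ` is an `h`-stable line on which `h` acts by some `γ₀ ≠ 0`.
Grade `ℂ^m` twice: source weight spaces `F_γ` (generalised eigenspaces of `h`) and target weight spaces
`E_β` (of `g`); then `Λ F_γ ⊆ E_γ` and `A_{kj} F_γ ⊆ E_{p_k q_j γ}`.  In bases adapted to the two gradings,
with `Λ` matched to the identity off the kernel line `s` and the cokernel line `t`, the matrix
`diag(0, I_{m-1}) + Σ x_{kj} A_{kj}` is a layered digraph: an `x`-edge multiplies the weight by
`p_k q_j > 1`, so the matched digraph is ACYCLIC and `det = κ · per_n` (`κ ≠ 0`) collapses to a signed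
sum over `s → t` paths ("Hamiltonian cycles through the pivot").  The coefficient of
`x_{1σ(1)} ⋯ x_{nσ(n)}` being `κ ≠ 0`, every permutation `σ` is spelled by a path, whose `i`-th vertex
is a generalised eigenvector of `g` of weight `γ₀ · ∏_{k ∈ I} p_k q_{σ(k)}` for an `i`-set `I` of rows
(vertex values = pairs `(I, σ(I))` of equal-size subsets, by unique factorisation).  That is **stub 1**.
**Stub 2** is the count: distinct pairs `(I, J)` give distinct weights (unique factorisation over the
`2n` distinct primes, `γ₀ ≠ 0`), a weight `(I, J)` serves only the `i!(n-i)!` permutations with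
`σ(I) = J`, so level `i` carries `≥ C(n, i)` weights of `g` (pigeonhole over `S_n`), the generalised
eigenspaces of `g` are independent, hence `m ≥ Σ_{i=1}^{n} C(n,i) = 2^n - 1`.
NO Weyl group (`S_n`) and no second torus element is used: the right torus enters only through the
column primes `q_j` of the one generic element — exactly the point where LR17 §6 needed `N(T^{GL(E)})`
(`supp_eq_univ_of_escape`, `full_of_ne_empty` in `LRWeightCount.lean` use permutation lifts).

## Stubs (registered; the ONLY `sorry`s of this file) and composition

* `stub_pathWeights` (size L, the heart — "graded normal form + Hamiltonian-path expansion"): for a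
  REGULAR affine determinantal representation `A` of `per_n` (`n ≥ 1`) and an exact lift `(g, h)` of the
  prime torus element as above, with `ker Λ ⊆ F_{γ₀}`: for every `σ ∈ S_n` and every level `1 ≤ i ≤ n`
  there is an `i`-subset `I ⊆ [n]` with `E_{γ₀ ∏_{k∈I} p_k q_{σ k}} ≠ 0` (generalised eigenspace of
  `toLin' g`).  Stated def-free over `IsRegularDetRepr`, `constPart`, `LRPencil.coeffMat`, `Matrix.toLin'`,
  `Module.End.maxGenEigenspace`.  Leans on (for its proof): `LRTorusWeights`/`GenericTorusGrading`
  (`map_maxGenEigenspace_le_of_comp_eq_smul`, eigenspace toolkit), `Matrix.det_apply` / Leibniz expansion,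
  `coeff` of `perPoly`.
* `stub_levelCount` (size M — "graded pigeonhole"): if `γ₀ ≠ 0` and every `σ` is served at every level
  `1 ≤ i ≤ n` by a weight `γ₀ ∏_{k∈I} p_k q_{σ k}` (`|I| = i`) of an endomorphism `toLin' g` of `ℂ^m`, then
  `2^n - 1 ≤ m`.  Pure arithmetic + linear algebra: unique factorisation
  (`TorusGrading.eq_of_prod_prime_pow_eq`-style over the `2n` primes), the coset-covering pigeonhole
  `|R_i| · i!(n-i)! ≥ n!`, `Module.End.independent_maxGenEigenspace` + `iSupIndep.subtype_ne_bot_le_finrank`,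
  `Σ_{i=1}^n C(n,i) = 2^n - 1` (`Nat.sum_range_choose`).
* COMPOSITION `TorusBound_of : Stmt.stub_pathWeights → Stmt.stub_levelCount → TorusBound` (kernel-checked,
  NO sorry; mirrors the set-up half of the tree's `two_pow_sub_one_le_of_isRegular`): regularity from
  von zur Gathen (tree theorem), the primes `p_i = nth prime i`, `q_j = nth prime (n + j)`, the torus element
  `diagUnit p ⊗ diagUnit q ∈` the two-sided torus (`diagonal_kronecker_diagonal`, `Subgroup.subset_closure`),
  its exact lift from `IsEquivariantDetRepr.exists_lift_stabilising` read on coefficient matrices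
  (`coeffMat_linSubstEntries`, `coeffMat_C_mul_mul_C`, `mul_eq_of_eq_mul_mul_inv`), `dim ker Λ = 1` from
  `rank Λ = m - 1`, the eigenvalue `γ₀ ≠ 0` of `h` on the kernel line
  (`LRPencil.exists_eigenvalue_of_finrank_ker_eq_one` via `liftOfMatrices … |>.map_ker_eq`), then stub 1,
  then stub 2.  `TorusBound_proof : TorusBound := TorusBound_of stub_pathWeights stub_levelCount` ties the
  `Stmt` copies to the registered stubs (the compiler checks they agree).

## Shape (skeleton audit by-name rule, as in `Cruxes/ContractiveHardness/Lines/birth.lean`)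
* `Stmt.stub_…` — the two stub statements as precise `Prop`s, named like the stubs;
* `stub_…` — the same statements as sorried theorems (the REGISTERED stubs; `sorry` occurs nowhere else);
* `TorusBound_of` — the composition, real proof; `TorusBound_proof` — the crux by name from the stubs;
* `RigidMinimalReps.TorusBound_of` / `RigidMinimalReps.TorusBound_proof` (§4) — the same for the stmt-5114 decl
  `RigidMinimalReps.TorusBound`, via `closure_twoSidedGens_le` + `IsEquivariantDetRepr.anti` + `TorusBound_of`.
Each stub can land as `Theorems/RigidityForcesSymmetryTorusBound<Stub>.lean` `--supports stmt-ValiantsHypothesis-4164`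
(equally `--supports stmt-ValiantsHypothesis-5114`: the same two stubs are registered on both items; ONE proof of the
two stubs closes BOTH crux items, by `TorusBound_proof` and `RigidMinimalReps.TorusBound_proof`).

## BC3 probes (registrar's folder `bc/TorusBound_probes.lean`, `bc/TorusBound_probes_1a_split.lean`)
`Stmt.stub_pathWeights → TorusBound`, `Stmt.stub_pathWeights → ValiantsHypothesis`,
`Stmt.stub_levelCount → TorusBound`, `Stmt.stub_levelCount → ValiantsHypothesis` by
`first | exact? | simpa [Stmt…] | (unfold Stmt…; simpa) | aesop` (maxHeartbeats 400000): ALL FAIL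
(`exact?` could not close the goal / assumption failed / aesop: failed after exhaustive search).
Neither stub is comparable to the crux by a cheap implication: stub 1 concludes weight occurrences, not a
size bound, and needs stub 2 + regularity + lift extraction to reach the crux; stub 2 is a statement about
an arbitrary endomorphism of `ℂ^m` and a served family of weights.

## BC3 probes for stmt-5114 (`RigidMinimalReps.TorusBound`)
Files `bc/TorusBound_probe_{1_pathWeights_crux,2_pathWeights_summit,3_levelCount_crux,4_levelCount_summit}.lean` in the
stmt-5114 registrar's folder (imports = `Theses.RigidMinimalReps` + `LandsbergRessayreProofs` only; the stub statements
restated verbatim; this file NOT imported).  For each stub `S ∈ {Stmt.stub_pathWeights, Stmt.stub_levelCount}` and each target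
`T ∈ {RigidMinimalReps.TorusBound, ValiantsHypothesis}`: nine `example`s — `S → T` by `exact?`, by `simpa`, by
`simpa [S]`, by `unfold S; simpa`, by `aesop`, by the combined `first | … |` battery, and `(h : S) : T` after
`unfold T` by `exact?`, `simpa using h`, `aesop` (maxHeartbeats 400000 each).  36/36 FAIL (`exact?` could not close
the goal; `assumption` failed; type mismatch after simplification; aesop: failed to prove the goal after exhaustive
search / made no progress; rc 1 for all four files, no timeouts, 2026-08-17).  bc3: pass for stmt-5114.

**Disproof used.** None exists: `Cruxes/TorusBound/` had no workfiles (no `Disproof.lean`, no `Negative/`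
lemma, no dead lines) at registration (2026-08-17); `ledger negatives --problem ValiantsHypothesis` (4 entries:
UlrichPadded adjugate ideal, Elusive candidate, GrenetRigidity optimal-uniqueness ×2) has nothing on
torus-equivariant representations — uniqueness of optimal representations (refuted) is NOT used here.
Sibling item stmt-ValiantsHypothesis-5114 (`RigidMinimalReps.TorusBound`, same statement up to the explicit
`d_i, e_j ≠ 0`) records the same proof plan in its docstring.  Hardest stub: `stub_pathWeights`.
-/

namespace Summit.ValiantsHypothesis.ValiantsHypothesis.Cruxes.TorusBound.Birth

open Matrix MvPolynomial Finset
open Literature.Computability.AlgebraicComplexity LRPencil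
open scoped Kronecker

-- `Summit.ValiantsHypothesis.ValiantsHypothesis.…` is the tree's mandated single-conjunct layout (Sub = Summit).
set_option linter.dupNamespace false

noncomputable section

/-! ## §1 The two stub statements as `Prop`s (named like the registered stubs) -/

/-- Statement of stub 1 (`stub_pathWeights`) — **every permutation is served at every level by a
weight of `g`.**  For a REGULAR affine determinantal representation `A` of `per_n` (`n ≥ 1`, size `m`)
and an exact lift `(g, h)` of the torus element `x_{kj} ↦ p_k q_j x_{kj}` (`2n` distinct primes) on the
constant and linear parts (`g Λ = Λ h`, `g A_{kj} = p_k q_j A_{kj} h`), with `ker Λ` inside the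
generalised `γ₀`-eigenspace of `h`: for every `σ ∈ S_n` and `1 ≤ i ≤ n` some `i`-subset `I` of rows has
`maxGenEigenspace (toLin' g) (γ₀ ∏_{k∈I} p_k q_{σ k}) ≠ ⊥`.  (Acyclic matched digraph ⇒ `det` = signed sum
of `s → t` paths; the path spelling `x_σ` visits these weights.) [cite: LandsbergRessayre2017, §6]
[cite: Grenet2011] -/
def Stmt.stub_pathWeights : Prop :=
  ∀ (n m : ℕ), 1 ≤ n →
    ∀ (A : Matrix (Fin m) (Fin m) (MvPolynomial (Fin n × Fin n) ℂ)) (p q : Fin n → ℕ)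
      (g h : GL (Fin m) ℂ) (γ₀ : ℂ),
      (∀ k, (p k).Prime) → (∀ j, (q j).Prime) → Function.Injective p → Function.Injective q →
      (∀ k j, p k ≠ q j) →
      IsRegularDetRepr (perPoly (Fin n) ℂ) A →
      (g : Matrix (Fin m) (Fin m) ℂ) * constPart A = constPart A * (h : Matrix (Fin m) (Fin m) ℂ) →
      (∀ k j : Fin n, (g : Matrix (Fin m) (Fin m) ℂ) * coeffMat A (k, j) =
          ((p k : ℂ) * (q j : ℂ)) • (coeffMat A (k, j) * (h : Matrix (Fin m) (Fin m) ℂ))) →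
      LinearMap.ker (Matrix.toLin' (constPart A)) ≤
        Module.End.maxGenEigenspace (Matrix.toLin' (h : Matrix (Fin m) (Fin m) ℂ)) γ₀ →
      ∀ (σ : Equiv.Perm (Fin n)) (i : ℕ), 1 ≤ i → i ≤ n →
        ∃ I : Finset (Fin n), I.card = i ∧
          Module.End.maxGenEigenspace (Matrix.toLin' (g : Matrix (Fin m) (Fin m) ℂ))
            (γ₀ * ∏ k ∈ I, ((p k : ℂ) * (q (σ k) : ℂ))) ≠ ⊥

/-- Statement of stub 2 (`stub_levelCount`) — **served weights force `2^n - 1 ≤ m`.**  If `γ₀ ≠ 0`,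
`p, q` are `2n` distinct primes and an endomorphism `toLin' g` of `ℂ^m` has, for every `σ ∈ S_n` and every
`1 ≤ i ≤ n`, a non-zero generalised eigenspace at `γ₀ ∏_{k∈I} p_k q_{σ k}` for some `i`-set `I`, then
`2^n - 1 ≤ m`: distinct pairs `(I, σ(I))` give distinct weights (unique factorisation), each serves only
`i!(n-i)!` permutations, so level `i` carries `≥ C(n,i)` independent eigenspaces, and
`Σ_{i=1}^n C(n,i) = 2^n - 1`. [cite: LandsbergRessayre2017, §6] [cite: MarcusMinc1961] -/
def Stmt.stub_levelCount : Prop :=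
  ∀ (n m : ℕ), 1 ≤ n → ∀ (g : Matrix (Fin m) (Fin m) ℂ) (p q : Fin n → ℕ) (γ₀ : ℂ),
    (∀ k, (p k).Prime) → (∀ j, (q j).Prime) → Function.Injective p → Function.Injective q →
    (∀ k j, p k ≠ q j) → γ₀ ≠ 0 →
    (∀ (σ : Equiv.Perm (Fin n)) (i : ℕ), 1 ≤ i → i ≤ n →
      ∃ I : Finset (Fin n), I.card = i ∧
        Module.End.maxGenEigenspace (Matrix.toLin' g) (γ₀ * ∏ k ∈ I, ((p k : ℂ) * (q (σ k) : ℂ))) ≠ ⊥) →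
    2 ^ n - 1 ≤ m

/-! ## §2 Registered stubs (the ONLY sorries of this file) -/

/-- **Registered stub 1 = `Stmt.stub_pathWeights`** (graded normal form + Hamiltonian-path expansion:
every `σ ∈ S_n` is served at every level `1 ≤ i ≤ n` by a weight `γ₀ ∏_{k∈I} p_k q_{σ k}`, `|I| = i`,
of the target-side lift `g`).  Size L; the hardest stub. [cite: LandsbergRessayre2017, §6] -/
theorem stub_pathWeights :
    ∀ (n m : ℕ), 1 ≤ n →
    ∀ (A : Matrix (Fin m) (Fin m) (MvPolynomial (Fin n × Fin n) ℂ)) (p q : Fin n → ℕ)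
      (g h : GL (Fin m) ℂ) (γ₀ : ℂ),
      (∀ k, (p k).Prime) → (∀ j, (q j).Prime) → Function.Injective p → Function.Injective q →
      (∀ k j, p k ≠ q j) →
      IsRegularDetRepr (perPoly (Fin n) ℂ) A →
      (g : Matrix (Fin m) (Fin m) ℂ) * constPart A = constPart A * (h : Matrix (Fin m) (Fin m) ℂ) →
      (∀ k j : Fin n, (g : Matrix (Fin m) (Fin m) ℂ) * coeffMat A (k, j) =
          ((p k : ℂ) * (q j : ℂ)) • (coeffMat A (k, j) * (h : Matrix (Fin m) (Fin m) ℂ))) →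
      LinearMap.ker (Matrix.toLin' (constPart A)) ≤
        Module.End.maxGenEigenspace (Matrix.toLin' (h : Matrix (Fin m) (Fin m) ℂ)) γ₀ →
      ∀ (σ : Equiv.Perm (Fin n)) (i : ℕ), 1 ≤ i → i ≤ n →
        ∃ I : Finset (Fin n), I.card = i ∧
          Module.End.maxGenEigenspace (Matrix.toLin' (g : Matrix (Fin m) (Fin m) ℂ))
            (γ₀ * ∏ k ∈ I, ((p k : ℂ) * (q (σ k) : ℂ))) ≠ ⊥ := by
  sorry

/-- **Registered stub 2 = `Stmt.stub_levelCount`** (graded pigeonhole: unique factorisation over the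
`2n` primes, `|R_i| · i!(n-i)! ≥ n!`, independence of generalised eigenspaces, `Σ_{i=1}^n C(n,i) = 2^n - 1`).
Size M. [cite: LandsbergRessayre2017, §6] -/
theorem stub_levelCount :
    ∀ (n m : ℕ), 1 ≤ n → ∀ (g : Matrix (Fin m) (Fin m) ℂ) (p q : Fin n → ℕ) (γ₀ : ℂ),
    (∀ k, (p k).Prime) → (∀ j, (q j).Prime) → Function.Injective p → Function.Injective q →
    (∀ k j, p k ≠ q j) → γ₀ ≠ 0 →
    (∀ (σ : Equiv.Perm (Fin n)) (i : ℕ), 1 ≤ i → i ≤ n →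
      ∃ I : Finset (Fin n), I.card = i ∧
        Module.End.maxGenEigenspace (Matrix.toLin' g) (γ₀ * ∏ k ∈ I, ((p k : ℂ) * (q (σ k) : ℂ))) ≠ ⊥) →
    2 ^ n - 1 ≤ m := by
  sorry

/-! ## §3 The composition (kernel-checked, sorry-free) -/

/-- Summing a family against a row of a diagonal matrix picks out the diagonal entry
(the substitution `x_v ↦ c_v x_v` on coefficient matrices). [folklore] -/
theorem sum_diagonal_smul {ι M : Type*} [Fintype ι] [DecidableEq ι] [AddCommMonoid M] [Module ℂ M]
    (c : ι → ℂ) (B : ι → M) (v : ι) :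
    ∑ i, (Matrix.diagonal c) v i • B i = c v • B v := by
  rw [Finset.sum_eq_single v]
  · rw [Matrix.diagonal_apply_eq]
  · intro i _ hi
    rw [Matrix.diagonal_apply_ne _ (Ne.symm hi), zero_smul]
  · intro hv
    exact absurd (Finset.mem_univ v) hv

/-- **The crux from the two stubs** (real proof).  Given a two-sided-torus-equivariant affine
determinantal representation `A` of `per_n`, `n ≥ 3`, of size `m`:
(0) `A` is regular (von zur Gathen 1987 Thm 3.1 = LR17 Lemma 3.2, a tree theorem);
(1) rows get the primes `p_i = P_i`, columns the primes `q_j = P_{n+j}` (`P` = the increasing enumeration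
of the primes), two disjoint injective families;
(2) the torus element `x_{kj} ↦ p_k q_j x_{kj}` is `diag(p) ⊗ diag(q) = diag(p_k q_j)`, a generator of the
two-sided torus;
(3) its exact lift `(g, h)` satisfies `g Λ = Λ h` and, reading coefficient matrices on both sides of
`Ã(t·x) = g Ã(x) h⁻¹`, `g A_{kj} = p_k q_j A_{kj} h`;
(4) `rank Λ = m - 1` makes `ker Λ` an `h`-stable line (`m ≥ 1` as `per_n(0) = 0 ≠ det` of the empty
matrix), on which `h` has an eigenvalue `γ₀ ≠ 0`;
(5) stub 1 serves every `σ` at every level, (6) stub 2 counts: `2^n - 1 ≤ m`.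
[cite: LandsbergRessayre2017, Thm. 2.8, §6] [cite: Vonzurgathen1987, Thm. 3.1] -/
theorem TorusBound_of :
    Stmt.stub_pathWeights → Stmt.stub_levelCount →
      Summit.ValiantsHypothesis.ValiantsHypothesis.Theses.RigidityForcesSymmetry.TorusBound := by
  intro hPW hLC
  unfold Stmt.stub_pathWeights at hPW
  unfold Stmt.stub_levelCount at hLC
  intro n hn m A hA
  classical
  -- (0) the affine data and regularity (von zur Gathen 1987, Thm. 3.1, proved in the tree)
  have haff : ∀ r c, (A r c).totalDegree ≤ 1 := hA.1.1
  have hdet : A.det = perPoly (Fin n) ℂ := hA.1.2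
  have hreg : IsRegularDetRepr (perPoly (Fin n) ℂ) A :=
    hA.isRegular_perPoly vonzurGathen1987_perm_detRepr_rank_holds hn
  -- (1) two disjoint families of distinct primes: rows `p`, columns `q`
  set p : Fin n → ℕ := fun i => Nat.nth Nat.Prime i with hpdef
  set q : Fin n → ℕ := fun j => Nat.nth Nat.Prime (n + j) with hqdef
  have hp : ∀ i, (p i).Prime := fun i => Nat.prime_nth_prime _
  have hq : ∀ j, (q j).Prime := fun j => Nat.prime_nth_prime _
  have hpinj : Function.Injective p := fun a b h =>
    Fin.ext (Nat.nth_injective Nat.infinite_setOf_prime h)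
  have hqinj : Function.Injective q := fun a b h => by
    have := Nat.nth_injective Nat.infinite_setOf_prime h
    exact Fin.ext (by omega)
  have hpq : ∀ i j, p i ≠ q j := fun i j h => by
    have := Nat.nth_injective Nat.infinite_setOf_prime h
    have := i.isLt
    omega
  have hp0 : ∀ i, ((fun i => (p i : ℂ)) i) ≠ 0 := fun i => Nat.cast_ne_zero.2 (hp i).ne_zero
  have hq0 : ∀ j, ((fun j => (q j : ℂ)) j) ≠ 0 := fun j => Nat.cast_ne_zero.2 (hq j).ne_zero
  -- (2) the generic two-sided torus element `x_{kj} ↦ p_k q_j x_{kj}` lies in the two-sided torus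
  let γ : GL (Fin n × Fin n) ℂ :=
    Matrix.GeneralLinearGroup.kronecker (diagUnit ℂ (fun i => (p i : ℂ)) hp0)
      (diagUnit ℂ (fun j => (q j : ℂ)) hq0)
  have hγcoe : (γ : Matrix (Fin n × Fin n) (Fin n × Fin n) ℂ) =
      Matrix.diagonal (fun v => (p v.1 : ℂ) * (q v.2 : ℂ)) := by
    show Matrix.diagonal _ ⊗ₖ Matrix.diagonal _ = _
    exact Matrix.diagonal_kronecker_diagonal _ _
  have hγmem : γ ∈ Subgroup.closure {γ : GL (Fin n × Fin n) ℂ | ∃ d e : Fin n → ℂ,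
      (γ : Matrix (Fin n × Fin n) (Fin n × Fin n) ℂ) = Matrix.diagonal (fun p => d p.1 * e p.2)} :=
    Subgroup.subset_closure ⟨fun i => (p i : ℂ), fun j => (q j : ℂ), hγcoe⟩
  -- (3) its exact lift `(g, h)`: `g Λ = Λ h` and `g A_{kj} = p_k q_j A_{kj} h`
  obtain ⟨g, h, hgh, hΛ⟩ := hA.exists_lift_stabilising hγmem
  have hAv : ∀ k j : Fin n, (g : Matrix (Fin m) (Fin m) ℂ) * coeffMat A (k, j) =
      ((p k : ℂ) * (q j : ℂ)) • (coeffMat A (k, j) * (h : Matrix (Fin m) (Fin m) ℂ)) := by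
    intro k j
    have e : coeffMat (Matrix.linSubstEntries γ A) (k, j) =
        coeffMat ((g : Matrix (Fin m) (Fin m) ℂ).map C * A *
          ((h⁻¹ : GL (Fin m) ℂ) : Matrix (Fin m) (Fin m) ℂ).map C) (k, j) := by rw [hgh]
    rw [coeffMat_linSubstEntries _ _ haff, hγcoe, sum_diagonal_smul, coeffMat_C_mul_mul_C] at e
    rw [mul_eq_of_eq_mul_mul_inv e, Matrix.smul_mul]
  -- (4) regularity: the kernel of `Λ` is a line, on which `h` has an eigenvalue `γ₀ ≠ 0`
  set Λm : Matrix (Fin m) (Fin m) ℂ := constPart A with hΛm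
  have hK : Module.finrank ℂ (LinearMap.ker (Matrix.toLin' Λm)) = 1 := by
    have h1 := LinearMap.finrank_range_add_finrank_ker (Matrix.toLin' Λm)
    rw [Module.finrank_fin_fun] at h1
    have h2 : Module.finrank ℂ (LinearMap.range (Matrix.toLin' Λm)) = m - 1 := by
      rw [Matrix.toLin'_apply']; exact hreg.2
    have hm : 1 ≤ m := by
      rcases Nat.eq_zero_or_pos m with h0 | h0
      · subst h0
        exfalso
        have h3 : A.det = 1 := Matrix.det_isEmpty
        have h4 := congrArg constantCoeff hdet
        rw [h3, constantCoeff_perPoly ℂ (by omega : 1 ≤ n), map_one] at h4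
        exact one_ne_zero h4
      · exact h0
    omega
  let L : Lift (Matrix.toLin' Λm) (fun _ _ : Fin n => Matrix.toLin' (0 : Matrix (Fin m) (Fin m) ℂ)) 1
      (fun _ => (1 : ℂ)) :=
    liftOfMatrices Λm (fun _ _ => 0) 1 _ (fun _ => one_ne_zero) g h hΛ (fun _ _ => by simp)
  obtain ⟨γ₀, hγ₀, hker⟩ := exists_eigenvalue_of_finrank_ker_eq_one _ L.C L.map_ker_eq hK
  have hker' : LinearMap.ker (Matrix.toLin' (constPart A)) ≤
      Module.End.maxGenEigenspace (Matrix.toLin' (h : Matrix (Fin m) (Fin m) ℂ)) γ₀ := hker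
  -- (5) stub 1: every permutation is served at every level by a weight of `g`
  have hserved := hPW n m (by omega) A p q g h γ₀ hp hq hpinj hqinj hpq hreg hΛ hAv hker'
  -- (6) stub 2: the served weights force `2^n - 1 ≤ m`
  exact hLC n m (by omega) (g : Matrix (Fin m) (Fin m) ℂ) p q γ₀ hp hq hpinj hqinj hpq hγ₀ hserved

/-- **THE SKELETON: the crux BY NAME, modulo exactly the two registered stubs** (the compiler checks
that the `Stmt` copies and the stub statements agree). [cite: LandsbergRessayre2017, Thm. 2.8] -/
theorem TorusBound_proof :
    Summit.ValiantsHypothesis.ValiantsHypothesis.Theses.RigidityForcesSymmetry.TorusBound :=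
  TorusBound_of stub_pathWeights stub_levelCount

/-! ## §4 The sibling crux `RigidMinimalReps.TorusBound` (stmt-ValiantsHypothesis-5114) from the SAME stubs

`RigidMinimalReps.TorusBound` quantifies over representations equivariant for
`Subgroup.closure {γ | ∃ d e, (∀ i, d i ≠ 0) ∧ (∀ j, e j ≠ 0) ∧ ↑γ = diagonal (fun p => d p.1 * e p.2)}`,
`RigidityForcesSymmetry.TorusBound` for the closure of the same set WITHOUT the two non-vanishing clauses.
For `γ ∈ GL`, `det (diagonal (d_k e_j)) = ∏ d_k e_j ≠ 0` forces every `d_i ≠ 0` and `e_j ≠ 0` (read the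
diagonal entries `(i, i)` and `(j, j)`), so the larger-looking generator set is contained in the smaller-looking
one, the closures agree, and equivariance for the stmt-5114 torus is equivariance for the stmt-4164 torus
(`IsEquivariantDetRepr.anti`).  Hence the §3 composition concludes stmt-5114's crux as well — no new stub, no
new `sorry`. -/

/-- The stmt-4164 generator set (all invertible `diag(d_k e_j)`) is contained in the stmt-5114 generator set
(the same with `d_i ≠ 0`, `e_j ≠ 0` recorded): invertibility of the diagonal matrix gives the non-vanishing.
[folklore] -/
theorem twoSidedGens_subset (n : ℕ) :
    {γ : GL (Fin n × Fin n) ℂ | ∃ d e : Fin n → ℂ,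
        (γ : Matrix (Fin n × Fin n) (Fin n × Fin n) ℂ) = Matrix.diagonal (fun p => d p.1 * e p.2)} ⊆
    {γ : Matrix.GeneralLinearGroup (Fin n × Fin n) ℂ | ∃ d e : Fin n → ℂ, (∀ i, d i ≠ 0) ∧ (∀ j, e j ≠ 0) ∧
        (γ : Matrix (Fin n × Fin n) (Fin n × Fin n) ℂ) = Matrix.diagonal (fun p => d p.1 * e p.2)} := by
  rintro γ ⟨d, e, hγ⟩
  have hdet : (γ : Matrix (Fin n × Fin n) (Fin n × Fin n) ℂ).det ≠ 0 := by
    rw [← Matrix.GeneralLinearGroup.val_det_apply]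
    exact Units.ne_zero _
  rw [hγ, Matrix.det_diagonal] at hdet
  have hne : ∀ i j : Fin n, d i * e j ≠ 0 := fun i j =>
    Finset.prod_ne_zero_iff.1 hdet (i, j) (Finset.mem_univ _)
  exact ⟨d, e, fun i => left_ne_zero_of_mul (hne i i), fun j => right_ne_zero_of_mul (hne j j), hγ⟩

/-- The two two-sided-torus subgroups: stmt-4164's closure is below stmt-5114's (in fact they are equal;
this is the inclusion the transfer needs). [folklore] -/
theorem closure_twoSidedGens_le (n : ℕ) :
    Subgroup.closure {γ : GL (Fin n × Fin n) ℂ | ∃ d e : Fin n → ℂ,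
        (γ : Matrix (Fin n × Fin n) (Fin n × Fin n) ℂ) = Matrix.diagonal (fun p => d p.1 * e p.2)} ≤
    Subgroup.closure {γ : Matrix.GeneralLinearGroup (Fin n × Fin n) ℂ | ∃ d e : Fin n → ℂ,
        (∀ i, d i ≠ 0) ∧ (∀ j, e j ≠ 0) ∧
        (γ : Matrix (Fin n × Fin n) (Fin n × Fin n) ℂ) = Matrix.diagonal (fun p => d p.1 * e p.2)} :=
  Subgroup.closure_mono (twoSidedGens_subset n)

namespace RigidMinimalReps

/-- **The stmt-5114 crux from the two stubs** (real proof): a representation equivariant for the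
stmt-5114 torus is equivariant for the stmt-4164 torus (`closure_twoSidedGens_le`, `IsEquivariantDetRepr.anti`),
and §3's `TorusBound_of` (regularity, one generic prime torus element, its exact lift, the kernel eigenvalue,
stub 1, stub 2) gives `2 ^ n - 1 ≤ m`. [cite: LandsbergRessayre2017, Thm. 2.8, §6] [cite: Vonzurgathen1987, Thm. 3.1] -/
theorem TorusBound_of :
    Stmt.stub_pathWeights → Stmt.stub_levelCount →
      Summit.ValiantsHypothesis.ValiantsHypothesis.Theses.RigidMinimalReps.TorusBound := by
  intro hPW hLC n hn m A hA
  have h := Birth.TorusBound_of hPW hLC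
  exact h n hn m A (hA.anti (closure_twoSidedGens_le n))

/-- **THE stmt-5114 SKELETON: `RigidMinimalReps.TorusBound` BY NAME, modulo exactly the two registered
stubs** `stub_pathWeights`, `stub_levelCount` (shared with stmt-4164). [cite: LandsbergRessayre2017, Thm. 2.8] -/
theorem TorusBound_proof :
    Summit.ValiantsHypothesis.ValiantsHypothesis.Theses.RigidMinimalReps.TorusBound :=
  TorusBound_of stub_pathWeights stub_levelCount

end RigidMinimalReps

end

end Summit.ValiantsHypothesis.ValiantsHypothesis.Cruxes.TorusBound.Birth
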